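import Mathlib
import Summits.Ventures.HSemireg.LineLawClassLawNecessity

/-!
# LINE LAW — COROLLARY F: a line with two small weights is never reached (ENGINE-W code B, #B18)

COROLLARY F of the LINE LAW (card LINE-LAW-B.md §24, consolidated text LINE-LAW-THEOREMS-B.md §6⁵): for `m < 0` a
coordinate weight line `S` with `gcd S = 1`, `|S| ≥ 2` and `(max S)² ≤ |m|` is NEVER factorwise reachable — «weight lines
with weights `≤ w` live only over imaginary node fields with `|m| < w²»` (data: the largest `|m| ≤ 1 000` with an aligned
cell is `132 < 12²`).  Hand proof: each weight ideal `𝔞_c(A) = (c, −A + √m)` has the REDUCED form `(c, 2b, ·)`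
(`b ≡ A (mod c)`, `|2b| ≤ c ≤ (b² − m)∕c` because `c² ≤ −m`); distinct weights give distinct reduced forms, hence distinct
classes (Cox Thm 2.8 + Thm 7.7), contradicting THEOREM E «⇒».  REF-W ROW 362 (PASS) sharpened the hypothesis (rider
P-CF-1): `c² ≤ |m|` may be replaced by `c (c − 1) < |m|` — since `c · k' = b² − m > c (c − 1)` already forces `k' ≥ c` —
and this bound is ATTAINED (`S = {c − 1, c}` at `m = −c (c − 1)` is aligned and reached, `c = 2 … 12`); this file proves
the SHARP form (in the boundary case `k' = c`, `b < 0` the `S`-flip `(c, −2b, c)` is the reduced representative).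
This file is that proof in kernel form, on top of #B17 (`LineLawClassLawNecessity.aligned_of_reached`: two weights of one
reached line satisfy `(z₁)·𝔞_{c₁}(A) = (z₂)·𝔞_{c₂}(A)`), #B16 (`LineLawPrincipalProper`: the weight forms are primitive)
and the tree's Literature: Cox (7.8) «⟸» `properEquiv_of_span_mul_ideal_eq` and Thm 2.8 uniqueness
`eq_of_properEquiv_of_isReduced` (`Literature.NumberTheory.QuadraticFields`).
* `weightForm_isPosPrim` — `(c, 2A, k)`, `c k = A² − m`, `c > 0`, primitive, is a primitive positive definite form of
  discriminant `4m`;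
* `exists_reduced_weightForm` — if moreover `c (c − 1) < −m` it is properly equivalent to a REDUCED such form with the
  same leading coefficient `c` (shift `A ↦ b ∈ (−c∕2, c∕2]`, plus the `S`-flip in the boundary case);
* `weights_eq_of_reached_small` — two weights `c₁, c₂` of one reached line (`T ∣ A² − m`, both weight forms primitive)
  with `cᵢ (cᵢ − 1) < −m` are EQUAL;
* `no_line_two_small_coprime_weights` — COROLLARY F for a coprime pair: distinct coprime `c₁, c₂` with
  `cᵢ (cᵢ − 1) < −m` carry no datum at all; `no_line_small_weights_of_bezout` — the Finset form: a family with
  `∑ aᵢ cᵢ = 1` containing two distinct weights `c` with `c (c − 1) < −m` carries no datum.  (`c² ≤ −m` implies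
  `c (c − 1) < −m` for `c > 0`, so the printed COROLLARY F is the special case — `no_line_small_weights_of_sq_le`.)
Honest framing: ideal ∕ form arithmetic for `ℤ√m` only; THEOREM CF⁶ (which words reach which lines) by value; Mukai vectors
and lattices elsewhere, not objects; nothing here says that HC, HC_CM or HC_AV holds.
-/

namespace Summit.Ventures.HSemireg.LineLawLargeDiscriminant

open Zsqrtd
open Literature.NumberTheory.QuadraticFields.Quadratic
open Literature.NumberTheory.QuadraticFields.Quadratic.BinQF (properEquiv_of_span_mul_ideal_eq
  eq_of_properEquiv_of_isReduced)
open Summit.Ventures.HSemireg.LineLawPrincipalGenus (ideal_lineForm)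
open Summit.Ventures.HSemireg.LineLawPrincipalProper (weightForm_primitive_at weightForm_primitive_of_bezout
  winding_dvd_of_coprime_pair winding_dvd_of_bezout)
open Summit.Ventures.HSemireg.LineLawClassLawNecessity (aligned_of_reached)

/-- The weight form `(c, 2A, k)` with `c k = A² − m`, `c > 0`, primitive, is a primitive positive definite form of
discriminant `4m` in the tree's sense (`BinQF.IsPosPrim`). -/
theorem weightForm_isPosPrim {m c A k : ℤ} (hc : 0 < c) (hk : c * k = A * A - m)
    (hprim : ∀ d : ℤ, d ∣ c → d ∣ 2 * A → d ∣ k → IsUnit d) :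
    (⟨c, 2 * A, k⟩ : BinQF).IsPosPrim (4 * m) where
  disc_eq := by simp only [BinQF.disc]; linear_combination (-4 : ℤ) * hk
  a_pos := hc
  primitive := (BinQF.isPrimitive_iff _).2 hprim

/-- **Reduction of a small weight form (sharp, REF-W P-CF-1).** For `m < 0`, `0 < c`, `c (c − 1) < −m`, `c k = A² − m`
and `(c, 2A, k)` primitive, the form `(c, 2A, k)` is properly equivalent to a REDUCED primitive positive definite form of
discriminant `4m` whose leading coefficient is still `c`: shift `A` to `b = A + c t ∈ (−c∕2, c∕2]` (action of `T^t`),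
so `|2b| ≤ c`, and `c · k' = b² − m ≥ −m > c (c − 1)` gives `k' ≥ c`; if `|2b| = c` then `2b = c > 0`; if `k' = c` and
`b < 0`, pass to the `S`-flip `(k', −2b, c) = (c, −2b, c)`, which is reduced. -/
theorem exists_reduced_weightForm {m c A k : ℤ} (hm : m < 0) (hc : 0 < c) (hsq : c * (c - 1) < -m)
    (hk : c * k = A * A - m) (hprim : ∀ d : ℤ, d ∣ c → d ∣ 2 * A → d ∣ k → IsUnit d) :
    ∃ g : BinQF, (⟨c, 2 * A, k⟩ : BinQF).ProperEquiv g ∧ g.IsPosPrim (4 * m) ∧ g.IsReduced ∧ g.a = c := by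
  have hf := weightForm_isPosPrim hc hk hprim
  -- a representative `b = A + c t` of `A mod c` with `-c < 2b ≤ c`
  obtain ⟨t, ht1, ht2⟩ : ∃ t : ℤ, -c < 2 * (A + c * t) ∧ 2 * (A + c * t) ≤ c := by
    have hr0 : 0 ≤ A % c := Int.emod_nonneg A hc.ne'
    have hrc : A % c < c := Int.emod_lt_of_pos A hc
    have hAr : A % c + c * (A / c) = A := Int.emod_add_mul_ediv A c
    by_cases h2 : 2 * (A % c) ≤ c
    · refine ⟨-(A / c), ?_, ?_⟩ <;> nlinarith [hAr]
    · refine ⟨-(A / c) - 1, ?_, ?_⟩ <;> nlinarith [hAr]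
  set b := A + c * t with hb
  set k' := c * t ^ 2 + 2 * A * t + k with hk'
  -- the shifted form and its properties
  have hshift : (⟨c, 2 * A, k⟩ : BinQF).ProperEquiv ⟨c, 2 * b, k'⟩ := by
    have e := BinQF.properEquiv_T (⟨c, 2 * A, k⟩ : BinQF) t
    convert e using 2
    simp only [hb]
    ring
  have hg : (⟨c, 2 * b, k'⟩ : BinQF).IsPosPrim (4 * m) := hshift.isPosPrim (by linarith) hf
  have hcc : c * k' = b * b - m := by rw [hb, hk']; linear_combination hk
  have hkc : c ≤ k' := by
    have h1 : c * (c - 1) < c * k' := by nlinarith [mul_self_nonneg b]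
    have h2 : c - 1 < k' := lt_of_mul_lt_mul_left h1 hc.le
    omega
  have habs : |2 * b| ≤ c := abs_le.2 ⟨by linarith, ht2⟩
  by_cases hcase : k' = c ∧ b < 0
  · -- boundary case: the `S`-flip `(k', -2b, c) = (c, -2b, c)` is the reduced representative
    obtain ⟨hk'c, hb0⟩ := hcase
    refine ⟨⟨k', -(2 * b), c⟩, hshift.trans (BinQF.properEquiv_S _), ?_, ?_, hk'c⟩
    · exact (hshift.trans (BinQF.properEquiv_S _)).isPosPrim (by linarith) hf
    · show |-(2 * b)| ≤ k' ∧ k' ≤ c ∧ (|-(2 * b)| = k' ∨ k' = c → 0 ≤ -(2 * b))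
      rw [abs_neg, hk'c]
      exact ⟨habs, le_rfl, fun _ => by linarith⟩
  · refine ⟨⟨c, 2 * b, k'⟩, hshift, hg, ?_, rfl⟩
    show |2 * b| ≤ c ∧ c ≤ k' ∧ (|2 * b| = c ∨ c = k' → 0 ≤ 2 * b)
    refine ⟨habs, hkc, ?_⟩
    rintro (h1 | h1)
    · rcases (abs_eq hc.le).1 h1 with h2 | h2 <;> linarith
    · by_contra hneg
      exact hcase ⟨h1.symm, by linarith⟩

/-- From «no prime divides `a, b, c`» to «every common divisor is a unit». -/
theorem isUnit_of_no_prime {a b c : ℤ} (h : ∀ q : ℤ, Prime q → q ∣ a → q ∣ b → q ∣ c → False) :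
    ∀ d : ℤ, d ∣ a → d ∣ b → d ∣ c → IsUnit d := by
  intro d ha hb hc
  by_contra hnu
  obtain ⟨q, hq, hqd⟩ : ∃ q : ℤ, Prime q ∧ q ∣ d :=
    Int.exists_prime_and_dvd (fun h1 => hnu (Int.isUnit_iff_natAbs_eq.2 h1))
  exact h q hq (dvd_trans hqd ha) (dvd_trans hqd hb) (dvd_trans hqd hc)

/-- A divisor datum has `z ≠ 0` and, for `m < 0`, `N z > 0`. -/
theorem norm_pos_of_datum {m A : ℤ} (hm : m < 0) {z w : ℤ√m} (h : z * w = ⟨A, -1⟩) : 0 < z.norm := by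
  have hz : z ≠ 0 := by
    rintro rfl
    have := congrArg Zsqrtd.im h
    simp at this
  exact lt_of_le_of_ne (Zsqrtd.norm_nonneg hm.le z) (fun h0 => hz ((Zsqrtd.norm_eq_zero_iff hm z).1 h0.symm))

/-- **Two small weights of one reached line are equal.**  Let `m < 0` and let the weights `c₁, c₂ > 0` lie on one line
reached at `(T, A)` — data `zᵢ · wᵢ = A − √m`, `T = cᵢ · N zᵢ` — with `T ∣ A² − m` and both weight forms
`(cᵢ, 2A, (A² − m)∕cᵢ)` primitive (both automatic when the line's weights have no common divisor: #B16).  If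
`c₁ (c₁ − 1) < −m` and `c₂ (c₂ − 1) < −m` (e.g. `cᵢ² ≤ −m`) then `c₁ = c₂`.  Proof: #B17 gives `(z₁)·𝔞_{c₁}(A) = (z₂)·𝔞_{c₂}(A)`; Cox (7.8) «⟸» turns
this into a proper equivalence of the two weight forms; each is properly equivalent to a reduced form with the same
leading coefficient (`exists_reduced_weightForm`); reduced forms in one class coincide (Cox Thm 2.8). -/
theorem weights_eq_of_reached_small {m A T c₁ c₂ k₁ k₂ : ℤ} (hm : m < 0) {z₁ w₁ z₂ w₂ : ℤ√m}
    (h₁ : z₁ * w₁ = ⟨A, -1⟩) (h₂ : z₂ * w₂ = ⟨A, -1⟩) (hT₁ : T = c₁ * z₁.norm) (hT₂ : T = c₂ * z₂.norm)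
    (hdiv : T ∣ A * A - m) (hc₁ : 0 < c₁) (hc₂ : 0 < c₂) (hk₁ : c₁ * k₁ = A * A - m) (hk₂ : c₂ * k₂ = A * A - m)
    (hp₁ : ∀ d : ℤ, d ∣ c₁ → d ∣ 2 * A → d ∣ k₁ → IsUnit d) (hp₂ : ∀ d : ℤ, d ∣ c₂ → d ∣ 2 * A → d ∣ k₂ → IsUnit d)
    (hs₁ : c₁ * (c₁ - 1) < -m) (hs₂ : c₂ * (c₂ - 1) < -m) : c₁ = c₂ := by
  have hn₁ := norm_pos_of_datum hm h₁
  have hT0 : T ≠ 0 := by rw [hT₁]; positivity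
  have hz₁ : z₁ ≠ 0 := by rintro rfl; have := congrArg Zsqrtd.im h₁; simp at this
  have hz₂ : z₂ ≠ 0 := by rintro rfl; have := congrArg Zsqrtd.im h₂; simp at this
  -- alignment (#B17), read on the forms' ideals
  have hal := aligned_of_reached h₁ h₂ hT₁ hT₂ hdiv hT0
  rw [← ideal_lineForm m c₁ k₁ A, ← ideal_lineForm m c₂ k₂ A] at hal
  have hf₁ := weightForm_isPosPrim hc₁ hk₁ hp₁
  have hf₂ := weightForm_isPosPrim hc₂ hk₂ hp₂
  have hequiv : (⟨c₁, 2 * A, k₁⟩ : BinQF).ProperEquiv ⟨c₂, 2 * A, k₂⟩ :=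
    properEquiv_of_span_mul_ideal_eq hm hf₁ hf₂ hz₁ hz₂ hal
  obtain ⟨g₁, hfg₁, hg₁, hg₁r, hg₁a⟩ := exists_reduced_weightForm hm hc₁ hs₁ hk₁ hp₁
  obtain ⟨g₂, hfg₂, hg₂, hg₂r, hg₂a⟩ := exists_reduced_weightForm hm hc₂ hs₂ hk₂ hp₂
  have hgg : g₁.ProperEquiv g₂ := (hfg₁.symm.trans hequiv).trans hfg₂
  have heq : g₁ = g₂ := eq_of_properEquiv_of_isReduced hg₁ hg₂ hg₁r hg₂r hgg
  rw [← hg₁a, ← hg₂a, heq]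

/-- **COROLLARY F for a coprime pair (sharp form).**  For `m < 0`, two DISTINCT coprime weights `c₁, c₂`
(`u c₁ + v c₂ = 1`) with `cᵢ (cᵢ − 1) < −m` never lie on one reached line: there is no residue `A`, winding `T` and data
`zᵢ · wᵢ = A − √m` with `T = cᵢ · N zᵢ`.  (All of LEMMA P's clauses are discharged from the data by #B16.) -/
theorem no_line_two_small_coprime_weights {m A T c₁ c₂ u v : ℤ} (hm : m < 0) {z₁ w₁ z₂ w₂ : ℤ√m}
    (h₁ : z₁ * w₁ = ⟨A, -1⟩) (h₂ : z₂ * w₂ = ⟨A, -1⟩) (hT₁ : T = c₁ * z₁.norm) (hT₂ : T = c₂ * z₂.norm)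
    (hc₁ : 0 < c₁) (hc₂ : 0 < c₂) (hbez : u * c₁ + v * c₂ = 1) (hs₁ : c₁ * (c₁ - 1) < -m)
    (hs₂ : c₂ * (c₂ - 1) < -m) (hne : c₁ ≠ c₂) : False := by
  have hn₁ := norm_pos_of_datum hm h₁
  have hn₂ := norm_pos_of_datum hm h₂
  have hT0 : T ≠ 0 := by rw [hT₁]; positivity
  have hdiv : T ∣ A * A - m := winding_dvd_of_coprime_pair h₁ h₂ hT₁ hT₂ hbez
  obtain ⟨k₁, hk₁⟩ : c₁ ∣ A * A - m := dvd_trans (Dvd.intro _ hT₁.symm) hdiv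
  obtain ⟨k₂, hk₂⟩ : c₂ ∣ A * A - m := dvd_trans (Dvd.intro _ hT₂.symm) hdiv
  -- coprimality: a prime dividing one weight misses the other
  have hcop : ∀ q : ℤ, Prime q → q ∣ c₁ → q ∣ c₂ → False := by
    intro q hq hq1 hq2
    have : q ∣ u * c₁ + v * c₂ := dvd_add (dvd_mul_of_dvd_right hq1 _) (dvd_mul_of_dvd_right hq2 _)
    rw [hbez] at this
    exact hq.not_unit (isUnit_of_dvd_one this)
  have hp₁ : ∀ d : ℤ, d ∣ c₁ → d ∣ 2 * A → d ∣ k₁ → IsUnit d :=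
    isUnit_of_no_prime fun q hq hqc hqA hqk =>
      weightForm_primitive_at h₁ h₂ hT₁ hT₂ hT0 hdiv hk₁.symm hq hqc (fun h' => hcop q hq hqc h') hqA hqk
  have hp₂ : ∀ d : ℤ, d ∣ c₂ → d ∣ 2 * A → d ∣ k₂ → IsUnit d :=
    isUnit_of_no_prime fun q hq hqc hqA hqk =>
      weightForm_primitive_at h₂ h₁ hT₂ hT₁ hT0 hdiv hk₂.symm hq hqc (fun h' => hcop q hq h' hqc) hqA hqk
  exact hne (weights_eq_of_reached_small hm h₁ h₂ hT₁ hT₂ hdiv hc₁ hc₂ hk₁.symm hk₂.symm hp₁ hp₂ hs₁ hs₂)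

/-- **COROLLARY F, family form.**  For `m < 0`, a finite family of positive weights `c i` (`i ∈ s`) with no common
divisor (`∑ a i · c i = 1`) that contains two DISTINCT weights `c i ≠ c j` with `c i (c i − 1) < −m`, `c j (c j − 1) < −m`
carries no datum of one line: no `A`, `T` and `z i · w i = A − √m` with `T = c i · N (z i)` for all `i ∈ s`.  In
particular (`|S| ≥ 2`, `max S · (max S − 1) < −m`): such a line is never reached — the sharp COROLLARY F (REF-W P-CF-1;
the bound is attained by `S = {c − 1, c}` at `m = −c (c − 1)`). -/
theorem no_line_small_weights_of_bezout {m A T : ℤ} (hm : m < 0) {ι : Type*} (s : Finset ι) (c a : ι → ℤ)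
    (z w : ι → ℤ√m) (h : ∀ i ∈ s, z i * w i = ⟨A, -1⟩) (hT : ∀ i ∈ s, T = c i * (z i).norm)
    (hpos : ∀ i ∈ s, 0 < c i) (hbez : ∑ i ∈ s, a i * c i = 1) {i j : ι} (hi : i ∈ s) (hj : j ∈ s)
    (hsi : c i * (c i - 1) < -m) (hsj : c j * (c j - 1) < -m) (hne : c i ≠ c j) : False := by
  have hni := norm_pos_of_datum hm (h i hi)
  have hT0 : T ≠ 0 := by rw [hT i hi]; have := hpos i hi; positivity
  have hdiv : T ∣ A * A - m := winding_dvd_of_bezout s c a z w h hT hbez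
  obtain ⟨kᵢ, hkᵢ⟩ : c i ∣ A * A - m := dvd_trans (Dvd.intro _ (hT i hi).symm) hdiv
  obtain ⟨kⱼ, hkⱼ⟩ : c j ∣ A * A - m := dvd_trans (Dvd.intro _ (hT j hj).symm) hdiv
  have hpᵢ := weightForm_primitive_of_bezout s c a z w h hT hbez hT0 hdiv hi hkᵢ.symm
  have hpⱼ := weightForm_primitive_of_bezout s c a z w h hT hbez hT0 hdiv hj hkⱼ.symm
  exact hne (weights_eq_of_reached_small hm (h i hi) (h j hj) (hT i hi) (hT j hj) hdiv (hpos i hi) (hpos j hj)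
    hkᵢ.symm hkⱼ.symm hpᵢ hpⱼ hsi hsj)

/-- The printed COROLLARY F (LINE-LAW-THEOREMS-B.md §6⁵: `(max S)² ≤ |m|`) as the special case `c² ≤ −m ⇒ c (c − 1) < −m`
of the sharp form. -/
theorem no_line_small_weights_of_sq_le {m A T : ℤ} (hm : m < 0) {ι : Type*} (s : Finset ι) (c a : ι → ℤ)
    (z w : ι → ℤ√m) (h : ∀ i ∈ s, z i * w i = ⟨A, -1⟩) (hT : ∀ i ∈ s, T = c i * (z i).norm)
    (hpos : ∀ i ∈ s, 0 < c i) (hbez : ∑ i ∈ s, a i * c i = 1) {i j : ι} (hi : i ∈ s) (hj : j ∈ s)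
    (hsi : c i * c i ≤ -m) (hsj : c j * c j ≤ -m) (hne : c i ≠ c j) : False :=
  no_line_small_weights_of_bezout hm s c a z w h hT hpos hbez hi hj
    (by nlinarith [hpos i hi]) (by nlinarith [hpos j hj]) hne

end Summit.Ventures.HSemireg.LineLawLargeDiscriminant
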